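import Literature.Geometry.Kaehler.ComplexTorusFourierCreationAnnihilation
import Literature.Geometry.Kaehler.ComplexTorusLefschetzWeylOperatorCAR
import Literature.Geometry.Kaehler.ComplexTorusSelfIntersection
import Literature.Geometry.Kaehler.ComplexTorusDualPolarization
import HarnessLib

/-!
# THE COHOMOLOGICAL FOURIER TRANSFORM OF A POLARISED COMPLEX TORUS IS THE WEYL ELEMENT OF THE LEFSCHETZ `𝔰𝔩₂`:
# `φ_H^* ∘ F = (−1)^g · d₁⋯d_g · w` on `H•(X; ℂ)` (Polishchuk 2007, Lemma 1.4: "`(−1)^g F_d = exp(e) exp(−f) exp(e)`")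

Layer `Literature/Geometry/Kaehler`, namespace `Literature.Geometry.Kaehler.ComplexTorus`; lane `lit-hodgefound` (Track 2 foundations
library), prover seat `lit-hodgefound-p09` (generation 51, row g51-#4, the assembly row of the four-file programme g51-#1 – g51-#4).
THEOREMS ONLY (no definition, no named fact, no instance, no notation; D-0026 net debt `0`).

SETTING. `X = E/Φ(ℤ^ι)` a complex torus of dimension `g` (`N = rk Λ = 2g`), `X̂ = Ω̄/Λ̂` its dual (`Ω̄ = E →L⋆[ℂ] ℂ`, `dualPeriod Φ`),
`F(x) = fourierForm Φ e h x = (1/m!) p_{2*}(p₁^*x ∧ cl(𝒫_X)^{∧m}) ∈ Hᵐ(X̂)` for `x ∈ Hᵏ(X)`, `k + m = N` (Lange (6.11); row A4-33⁺⁺),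
`η` a real `2`-form on `E` and `φ : E →L[ℝ] Ω̄` a real-linear map with `Im φ(u)(w) = η(u, w)` — for `η = Im H` of type `(1,1)` this is
the analytic representation `φ_H : v ↦ H(v, ·)` of `φ_L : X → X̂` (Lange Lemma 1.4.5; tree `phiHRep`, `im_phiHFun`). On the total space
`H•(X; ℂ) = GForm E ℂ = ⊕ₖ Alt^k_ℝ(E; ℂ)` the Lefschetz triple `(L_η, Λ_η, H)` of a non-degenerate `η` has the Weyl operator
`w = exp(Λ) exp(−L) exp(Λ)` (`HasLefschetzProperty.weylOperator`, André's image of `(0 1 ; −1 0) ∈ SL₂`), and we write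
`T(x) := φ^*F(x) ∈ H^m(X)` for the Fourier transform TRANSPORTED BACK TO `X` along `φ` (Polishchuk's `χ(d)·F_d = φ^* ∘ F`).

## What is proved

* §1 `torusIntegral_volumeForm_dual_compContinuousLinearMap`, `volumeForm_dual_compContinuousLinearMap`: **`φ^* vol_X̂ = ε ε̂ · det(E) · vol_X`**
  (`det E = det(η(λᵢ, λⱼ)) = polarizationDegree Φ η = deg φ_L`, `ε, ε̂` the orientation signs of the lattice frames of `X`, `X̂`), and
  **`fourierForm_one_compContinuousLinearMap`: `φ^*F(1) = (−1)^g det(E) · vol_X`** (with `F(1) = (−1)^g ε ε̂ vol_X̂`, Prop. 6.2.20 for `p = 0`).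
* §2 **`curryLeftG_of_fourierForm_compContinuousLinearMap`: `T(ξ ∧ y) = ξ♯ ⌟ T(y)`** with `η(w, ξ♯) = ξ(w)` — the transported Fourier
  transform obeys THE SAME creation-to-annihilation exchange rule as the Weyl operator (row g51-#2 `weylOperator_wedgeOneG`:
  `w(ξ ∧ x) = ξ♯ ⌟ w(x)`); from row g51-#3 (`F((Im v̂) ∧ x) = −v̂ ⌟ F(x)`, (6.11)) with `v̂ = φ(−ξ♯)` and `u ⌟ φ^*Θ = φ^*((φ u) ⌟ Θ)`.
* §3 **`of_fourierForm_compContinuousLinearMap_eq_smul_weylOperator` (RIGIDITY): if `T(1) = c · w(1)` then `T = c · w` on all of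
  `H•(X; ℂ)`** — both are `ℂ`-linear, obey the exchange rule, and the wedge monomials `dx_{a₁} ∧ ⋯ ∧ dx_{a_k}` of the lattice coordinate
  frame span `Hᵏ(X; ℂ)` (`span_wedgeWord_const_eq_top`); induction on `k`.
* §4 **`IsPolarizationType.of_fourierForm_compContinuousLinearMap` (THE THEOREM): for a polarisation `η` of type `(d₁, …, d_g)`,
  `φ^*(F x) = (−1)^g d₁⋯d_g · w(x)` for every `x ∈ Hᵏ(X; ℂ)`, `0 ≤ k ≤ 2g`** — on `H⁰`: `φ^*F(1) = (−1)^g (d₁⋯d_g)² vol_X` (§1,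
  `det E = (d₁⋯d_g)²`) while `w(1) = ((−1)^g/g!) η^{∧g} = d₁⋯d_g · vol_X` (`∫_X η^{∧g} = (−1)^g g! d₁⋯d_g`, Lemma 1.7.5);
  `IsPolarizationType.weylOperator_of_zero_oneForm₀` (`w(1) = d₁⋯d_g·[pt]`), `IsPolarizationType.of_fourierForm_comp_phiHRep` (the same
  with `φ = φ_H`), and `IsPrincipalPolarization.of_fourierForm_comp_phiHRep`: **for a principally polarised torus `φ_H^* ∘ F = (−1)^g · w`.**
  In Polishchuk's normalisation `F_d = χ(d)⁻¹ φ^* ∘ F`, `χ(d) = d₁⋯d_g = √deg φ_L`, this reads `(−1)^g F_d = w`: the cohomological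
  Fourier transform IS, up to the printed sign, the Weyl element of the Lefschetz `𝔰𝔩₂` — the tree's form of his Lemma 1.4 (his
  `exp(e) exp(−f) exp(e)` is written in his conventions for `e`, `f`; no dictionary between those and the tree's `(L_η, Λ_η)` is asserted
  here beyond the proved identity).

## Sources, VERBATIM

* A. Polishchuk, *Fourier-stable subrings in the Chow rings of abelian varieties* (2007) [Polishchuk2007FourierStable], §1 p. 3 (held text
  `paper:arxiv-0705.0772`, p0003 L69–L117): "`F_d = (1/χ(d)) φ^* ∘ F`", "where `χ(d)` is the square root of the degree of the isogeny
  `φ : A → Â` associated with `d`"; "**Lemma 1.4.** The operators `F_d`, `e` and `f` associated with a polarization `d` on an abelian scheme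
  `A/S` satisfy `(−1)^g F_d = exp(e) exp(−f) exp(e)`."; proof: "`χ(d) F_d(x) = φ^* p_{2*}(e^{c₁(𝒫)} · p₁^* x)`, where `𝒫` is the Poincaré
  line bundle".
* H. Lange, *Abelian Varieties over the Complex Numbers* (2023) [Lange2023AbelianVarietiesComplex]: §6.2.4 (6.11) p. 311 and Prop. 6.2.20
  p. 310 (`F`, `F(1) = (−1)^g f₁ ∧ ⋯ ∧ f_{2g}`); §1.4.2 Lemma 1.4.5 (`φ_H`); §1.5.1 and Prop. 1.4.7 (`deg φ_L = det E = (d₁⋯d_g)²`);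
  §1.7.2 Lemma 1.7.5 (`∧^g E = (−1)^g g! d₁⋯d_g dx₁ ∧ dy₁ ∧ ⋯`).
* N. Bourbaki, *Lie Groups and Lie Algebras, Chs. 7–9* [Bourbaki2008LieGroups79], Ch. VIII §1 no. 5 (p. 96): the element `θ(t)` and its
  action `θ(t)u = −t⁻¹ v`, `θ(t)v = t u` on a doublet (rows g51-#1/#2).
* Y. André, *Pour une théorie inconditionnelle des motifs* (1996) [Andre1996Motifs], §1.2 (p. 11): `w` as the image of `(0 1 ; −1 0)`.

## Scope

Everything is stated for the tree's `fourierForm` (invariant forms = complex cohomology) and an ARBITRARY real-linear `φ` with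
`Im φ(u)(w) = η(u, w)`; §§1–3 need no polarisation (only `η` non-degenerate in §3), §4 needs a Riemann form with a type. Not done here:
Chow-theoretic statements, the relation `F_d² = (−1)^g[−1]^*`, and Polishchuk's `exp(e)exp(−f)exp(e)` in his own normalisation of `e, f`.
-/

noncomputable section

-- `Module ℂ` / `SMulZeroClass ℂ` synthesis on `E [⋀^Fin k]→L[ℝ] ℂ` (as in `ComplexTorusLefschetzDecomposition`)
set_option maxSynthPendingDepth 3

namespace Literature.Geometry.Kaehler

namespace ComplexTorus

open Module Function Finset
open Literature.LinearAlgebra.Alternating Literature.Algebra.Lie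
open Literature.Analysis.Complex (oneForm₀ oneForm₀_apply)

universe uE

variable {ι : Type*} [Fintype ι] [DecidableEq ι] {E : Type uE} [NormedAddCommGroup E] [NormedSpace ℂ E]
  (Φ : (ι → ℝ) ≃L[ℝ] E) {η : E [⋀^Fin 2]→L[ℝ] ℝ} {N : ℕ}

/-! ## §0 Pull-back plumbing -/

section Plumbing

omit [Fintype ι] [DecidableEq ι] in
/-- `u ⌟ (g^*T) = g^*((g u) ⌟ T)`, read from right to left. [cite: Warner1983, 2.11] -/
private theorem compContinuousLinearMap_curryLeft₅₂ {V W : Type*} [NormedAddCommGroup V] [NormedSpace ℝ V] [NormedAddCommGroup W]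
    [NormedSpace ℝ W] {k : ℕ} (T : V [⋀^Fin (k + 1)]→L[ℝ] ℂ) (g : W →L[ℝ] V) (w : W) :
    (T.curryLeft (g w)).compContinuousLinearMap g = (T.compContinuousLinearMap g).curryLeft w := by
  ext u
  simp only [ContinuousAlternatingMap.curryLeft_apply_apply, ContinuousAlternatingMap.compContinuousLinearMap_apply]
  congr 1
  funext j
  refine Fin.cases ?_ (fun i ↦ ?_) j <;> rfl

omit [Fintype ι] [DecidableEq ι] in
/-- `g^*(c T) = c g^*T`. [cite: Warner1983, 2.22] -/
private theorem smul_compContinuousLinearMap₅₂ {V W : Type*} [NormedAddCommGroup V] [NormedSpace ℝ V] [NormedAddCommGroup W]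
    [NormedSpace ℝ W] {k : ℕ} (c : ℂ) (T : V [⋀^Fin k]→L[ℝ] ℂ) (g : W →L[ℝ] V) :
    (c • T).compContinuousLinearMap g = c • T.compContinuousLinearMap g := by
  ext u; rfl

omit [Fintype ι] [DecidableEq ι] in
/-- `g^*(T + T') = g^*T + g^*T'`. [cite: Warner1983, 2.22] -/
private theorem add_compContinuousLinearMap₅₂ {V W : Type*} [NormedAddCommGroup V] [NormedSpace ℝ V] [NormedAddCommGroup W]
    [NormedSpace ℝ W] {k : ℕ} (T T' : V [⋀^Fin k]→L[ℝ] ℂ) (g : W →L[ℝ] V) :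
    (T + T').compContinuousLinearMap g = T.compContinuousLinearMap g + T'.compContinuousLinearMap g := by
  ext u; rfl

/-- `T = φ^* ∘ F` is additive on `Hᵏ(X)`. [cite: Lange2023AbelianVarietiesComplex, §6.2.4 p. 309] -/
private theorem of_fourierForm_compContinuousLinearMap_add (e : Fin N ≃ ι) (φ : E →L[ℝ] (E →L⋆[ℂ] ℂ)) {k m : ℕ} (h : k + m = N)
    (x y : E [⋀^Fin k]→L[ℝ] ℂ) :
    GForm.of m ((fourierForm Φ e h (x + y)).compContinuousLinearMap φ) =
      GForm.of m ((fourierForm Φ e h x).compContinuousLinearMap φ) + GForm.of m ((fourierForm Φ e h y).compContinuousLinearMap φ) := by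
  rw [fourierForm_add, add_compContinuousLinearMap₅₂, GForm.of_add]

/-- `T = φ^* ∘ F` is `ℂ`-homogeneous on `Hᵏ(X)`. [cite: Lange2023AbelianVarietiesComplex, §6.2.4 p. 311] -/
private theorem of_fourierForm_compContinuousLinearMap_smul (e : Fin N ≃ ι) (φ : E →L[ℝ] (E →L⋆[ℂ] ℂ)) {k m : ℕ} (h : k + m = N)
    (a : ℂ) (x : E [⋀^Fin k]→L[ℝ] ℂ) :
    GForm.of m ((fourierForm Φ e h (a • x)).compContinuousLinearMap φ) =
      a • GForm.of m ((fourierForm Φ e h x).compContinuousLinearMap φ) := by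
  rw [fourierForm_smul, smul_compContinuousLinearMap₅₂, GForm.of_smul]

omit [Fintype ι] [DecidableEq ι] in
/-- `c · W ∘ (of k)` is additive, for a `ℂ`-linear `W`. [folklore] -/
private theorem smul_end_of_add (W : Module.End ℂ (GForm E ℂ)) (c : ℂ) (k : ℕ) (x y : E [⋀^Fin k]→L[ℝ] ℂ) :
    c • W (GForm.of k (x + y)) = c • W (GForm.of k x) + c • W (GForm.of k y) := by
  rw [GForm.of_add, map_add, smul_add]

omit [Fintype ι] [DecidableEq ι] in
/-- `c · W ∘ (of k)` is `ℂ`-homogeneous, for a `ℂ`-linear `W`. [folklore] -/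
private theorem smul_end_of_smul (W : Module.End ℂ (GForm E ℂ)) (c a : ℂ) (k : ℕ) (x : E [⋀^Fin k]→L[ℝ] ℂ) :
    c • W (GForm.of k (a • x)) = a • (c • W (GForm.of k x)) := by
  rw [GForm.of_smul, map_smul, smul_comm]

end Plumbing

/-! ## §1 `φ^* vol_X̂ = ε ε̂ det(E) · vol_X` and `φ^* F(1) = (−1)^g det(E) · vol_X` -/

section DegreeZero

/-- **`∫_X φ^* vol_X̂ = ε ε̂ · det E`**: the pull-back of the fundamental class of `X̂` along a real-linear `φ : V → Ω̄` with
`Im φ(u)(w) = η(u, w)` integrates to the determinant `det(η(λᵢ, λⱼ)) = polarizationDegree Φ η` of the lattice form (`= deg φ_L`,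
Lange Prop. 1.4.7 / §1.5.1: the matrix of `φ_H` in the bases `λ` of `Λ` and `λ̂` of `Λ̂` is `ᵗE`, `dualPeriod_transposeGram_mulVec`), times
the orientation signs `ε = sign_X(e)`, `ε̂ = sign_X̂(e)` of the two lattice frames (both `±1`; for `φ` not `ℂ`-linear they need not cancel).
[cite: Lange2023AbelianVarietiesComplex, §1.4.2 Lemma 1.4.5 with (1.14); §1.5.1 and Prop. 1.4.7] -/
theorem torusIntegral_volumeForm_dual_compContinuousLinearMap (φ : E →L[ℝ] (E →L⋆[ℂ] ℂ)) (hφ : ∀ u w, (φ u w).im = η ![u, w])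
    (e : Fin N ≃ ι) :
    torusIntegral Φ e ((volumeForm (dualPeriod Φ) e).compContinuousLinearMap φ) =
      ((orientationSign Φ e * orientationSign (dualPeriod Φ) e : ℤ) : ℂ) * ((polarizationDegree Φ η : ℝ) : ℂ) := by
  have hM : (latticeBasis (dualPeriod Φ) e).toMatrix (φ ∘ latticeFrame Φ e) = ((latticeGram Φ η).submatrix e e).transpose := by
    ext i j
    rw [Module.Basis.toMatrix_apply, latticeBasis_repr, dualPeriod_symm_apply, Function.comp_apply, latticeFrame_apply, hφ,
      Matrix.transpose_apply, Matrix.submatrix_apply, latticeGram_apply]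
  have hdet : (latticeBasis (dualPeriod Φ) e).det (φ ∘ latticeFrame Φ e) = (latticeGram Φ η).det := by
    rw [Module.Basis.det_apply, hM, Matrix.det_transpose, Matrix.det_submatrix_equiv_self]
  rw [torusIntegral, ContinuousAlternatingMap.compContinuousLinearMap_apply, volumeForm_apply, hdet, polarizationDegree_eq_det]
  push_cast
  ring

/-- **`φ^* vol_X̂ = ε ε̂ · det(E) · vol_X`** in `H^{2g}(X; ℂ)`. [cite: Lange2023AbelianVarietiesComplex, §1.4.2 Lemma 1.4.5; §1.5.1 and Prop. 1.4.7; §6.2.4 p. 310] -/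
theorem volumeForm_dual_compContinuousLinearMap (φ : E →L[ℝ] (E →L⋆[ℂ] ℂ)) (hφ : ∀ u w, (φ u w).im = η ![u, w]) (e : Fin N ≃ ι) :
    (volumeForm (dualPeriod Φ) e).compContinuousLinearMap φ =
      (((orientationSign Φ e * orientationSign (dualPeriod Φ) e : ℤ) : ℂ) * ((polarizationDegree Φ η : ℝ) : ℂ)) • volumeForm Φ e := by
  rw [eq_torusIntegral_smul_volumeForm Φ e ((volumeForm (dualPeriod Φ) e).compContinuousLinearMap φ),
    torusIntegral_volumeForm_dual_compContinuousLinearMap Φ φ hφ e]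

/-- **`φ^* F(1) = (−1)^g · det(E) · vol_X`**: the Fourier transform of the unit class, `F(1) = (−1)^g ε ε̂ · vol_X̂` (Prop. 6.2.20 for
`p = 0`, `fourierForm_one_eq`), pulled back along `φ`; the orientation signs square away (`g = dim_ℂ X`, `det E = polarizationDegree Φ η`).
This is Polishchuk's `χ(d) F_d(1) = φ^*F(1)` in top degree. [cite: Lange2023AbelianVarietiesComplex, §6.2.4 Prop. 6.2.20 p. 310; §1.5.1]
[cite: Polishchuk2007FourierStable, §1 Lemma 1.4 (proof, p. 3)] -/
theorem fourierForm_one_compContinuousLinearMap (φ : E →L[ℝ] (E →L⋆[ℂ] ℂ)) (hφ : ∀ u w, (φ u w).im = η ![u, w]) (e : Fin N ≃ ι)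
    (h : 0 + N = N) :
    (fourierForm Φ e h (oneForm₀ E)).compContinuousLinearMap φ =
      ((-1 : ℂ) ^ finrank ℂ E * ((polarizationDegree Φ η : ℝ) : ℂ)) • volumeForm Φ e := by
  rw [fourierForm_one_eq Φ e e h, smul_compContinuousLinearMap₅₂, volumeForm_dual_compContinuousLinearMap Φ φ hφ e, smul_smul]
  congr 1
  have h1 : (orientationSign Φ e : ℂ) * orientationSign Φ e = 1 := by exact_mod_cast orientationSign_mul_self Φ e
  have h2 : (orientationSign (dualPeriod Φ) e : ℂ) * orientationSign (dualPeriod Φ) e = 1 := by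
    exact_mod_cast orientationSign_mul_self (dualPeriod Φ) e
  push_cast
  linear_combination ((-1 : ℂ) ^ finrank ℂ E * ((polarizationDegree Φ η : ℝ) : ℂ) *
      ((orientationSign (dualPeriod Φ) e : ℂ) * orientationSign (dualPeriod Φ) e)) * h1 +
    ((-1 : ℂ) ^ finrank ℂ E * ((polarizationDegree Φ η : ℝ) : ℂ)) * h2

end DegreeZero

/-! ## §2 The exchange rule of `T = φ^* ∘ F`: `T(ξ ∧ y) = ξ♯ ⌟ T(y)` -/

section Exchange

variable [FiniteDimensional ℂ E]

/-- **`φ^*F(ξ ∧ y) = ξ♯ ⌟ φ^*F(y)`, `η(w, ξ♯) = ξ(w)`**: the Fourier transform transported back to `X` carries the creation operator of a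
real covector `ξ` to the annihilation operator of its `η`-dual vector — THE SAME exchange rule as the Weyl operator of `(L_η, Λ_η, H)`
(`weylOperator_wedgeOneG`). From (6.11) in the form `F(ξ ∧ y) = −v̂ ⌟ F(y)` for `Im v̂ = ξ` (row g51-#3) with `v̂ = φ(−ξ♯)`
(`Im φ(−ξ♯)(u) = η(−ξ♯, u) = η(u, ξ♯) = ξ(u)`) and `u ⌟ φ^*Θ = φ^*((φ u) ⌟ Θ)`; stated on `GForm E ℂ` (`k + (m+1) = N = 2g`).
[cite: Lange2023AbelianVarietiesComplex, §6.2.4 (6.11) p. 311; Prop. 6.2.20 p. 310] [cite: Polishchuk2007FourierStable, §1 Lemma 1.4 (p. 3)] -/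
theorem curryLeftG_of_fourierForm_compContinuousLinearMap (hN : Even N) (e : Fin N ≃ ι) (φ : E →L[ℝ] (E →L⋆[ℂ] ℂ))
    (hφ : ∀ u w, (φ u w).im = η ![u, w]) {ξ : E →L[ℝ] ℝ} {v : E} (hv : ∀ w, η ![w, v] = ξ w) {k m : ℕ} (h : k + (m + 1) = N)
    (h' : k + 1 + m = N) (y : E [⋀^Fin k]→L[ℝ] ℂ) :
    GForm.of m ((fourierForm Φ e h' (wedgeOne ξ y)).compContinuousLinearMap φ) =
      GForm.curryLeftG v (GForm.of (m + 1) ((fourierForm Φ e h y).compContinuousLinearMap φ)) := by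
  haveI : FiniteDimensional ℝ (E →L⋆[ℂ] ℂ) := finiteDimensional_real (dualPeriod Φ) e
  haveI : FiniteDimensional ℂ (E →L⋆[ℂ] ℂ) := Module.Finite.of_restrictScalars_finite ℝ ℂ _
  have hξ : ∀ u, ξ u = (φ (-v) u).im := fun u ↦ by
    rw [hφ, ← neg_one_smul ℝ v, twoForm_smul_left, twoForm_swap η v u, hv u]
    ring
  rw [fourierForm_wedgeOne Φ hN e h h' y (φ (-v)) hξ, map_neg, map_neg, neg_neg, compContinuousLinearMap_curryLeft₅₂,
    GForm.curryLeftG_of_succ]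

end Exchange

/-! ## §3 Rigidity: `T(1) = c · w(1) ⟹ T = c · w` on all of `H•(X; ℂ)` -/

section Rigidity

variable [FiniteDimensional ℂ E] [Nontrivial E]

/-- **RIGIDITY OF THE EXCHANGE RULE: if `φ^*F(1) = c · w(1)` then `φ^*F(x) = c · w(x)` for every `x ∈ Hᵏ(X; ℂ)` and every `k`**
(`w` the Weyl operator of the Lefschetz `𝔰𝔩₂` of a non-degenerate `η`, `φ` real-linear with `Im φ(u)(w) = η(u, w)`). Both sides are
`ℂ`-linear in `x` and obey `R(ξ ∧ y) = ξ♯ ⌟ R(y)` (§2 and `weylOperator_wedgeOneG`), and the monomials `dx_{a₁} ∧ ⋯ ∧ dx_{a_k} ∧ 1`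
of the lattice coordinate frame span `Hᵏ(X; ℂ)` (`span_wedgeWord_const_eq_top`); induction on `k`. The degree is carried as
`k + m = N` (`= 2g`); `h₀ : 0 + N = N` indexes `F(1) ∈ H^{2g}(X̂)`. This is the uniqueness half of "`(−1)^g F_d = exp(e)exp(−f)exp(e)`":
an operator with the exchange rule is determined by its value on `H⁰`.
[cite: Polishchuk2007FourierStable, §1 Lemma 1.4 (p. 3)] [cite: Bourbaki2008LieGroups79, Ch. VIII §1 no. 5 (p. 96)] -/
theorem of_fourierForm_compContinuousLinearMap_eq_smul_weylOperator (hη : ∀ v : E, v ≠ 0 → ∃ w : E, η ![v, w] ≠ 0)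
    (φ : E →L[ℝ] (E →L⋆[ℂ] ℂ)) (hφ : ∀ u w, (φ u w).im = η ![u, w]) (e : Fin N ≃ ι) (h₀ : 0 + N = N) {c : ℂ}
    (hc : GForm.of N ((fourierForm Φ e h₀ (oneForm₀ E)).compContinuousLinearMap φ) =
      c • (hasLefschetzProperty_lefschetzG hη).weylOperator isZGrading_countingG (GForm.of 0 (oneForm₀ E)))
    {k m : ℕ} (h : k + m = N) (x : E [⋀^Fin k]→L[ℝ] ℂ) :
    GForm.of m ((fourierForm Φ e h x).compContinuousLinearMap φ) =
      c • (hasLefschetzProperty_lefschetzG hη).weylOperator isZGrading_countingG (GForm.of k x) := by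
  classical
  have hN : Even N := ⟨finrank ℂ E, by have := finrank_complex_mul_two Φ e; omega⟩
  -- Step 1: the identity on the wedge monomials `dx_{w 0} ∧ ⋯ ∧ dx_{w (k-1)} ∧ 1` of the lattice coordinate frame
  have hword : ∀ (k : ℕ) (w : Fin k → ι) (m : ℕ) (h : k + m = N),
      GForm.of m ((fourierForm Φ e h (wedgeWord (fun a ↦ (coord Φ a).smulRight (1 : ℂ)) (oneForm₀ E) k w)).compContinuousLinearMap φ) =
        c • (hasLefschetzProperty_lefschetzG hη).weylOperator isZGrading_countingG
          (GForm.of k (wedgeWord (fun a ↦ (coord Φ a).smulRight (1 : ℂ)) (oneForm₀ E) k w)) := by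
    intro k
    induction k with
    | zero =>
      intro w m h
      obtain rfl : m = N := by omega
      exact hc
    | succ k ih =>
      intro w m h
      obtain ⟨v, hv, -⟩ := exists_unique_dual_vector hη (coord Φ (w 0))
      rw [wedgeWord_succ, wedgeOne_smulRight_one,
        curryLeftG_of_fourierForm_compContinuousLinearMap Φ hN e φ hφ hv (by omega : k + (m + 1) = N) h,
        ih (Fin.tail w) (m + 1) (by omega), GForm.curryLeftG_smul_complex, ← GForm.wedgeOneG_of,
        weylOperator_wedgeOneG hη hv]
  -- Step 2: both sides are `ℂ`-linear in `x`, and the monomials span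
  obtain ⟨T, hT⟩ : ∃ T : (E [⋀^Fin k]→L[ℝ] ℂ) →ₗ[ℂ] GForm E ℂ,
      ∀ x, T x = GForm.of m ((fourierForm Φ e h x).compContinuousLinearMap φ) :=
    ⟨⟨⟨fun x ↦ GForm.of m ((fourierForm Φ e h x).compContinuousLinearMap φ),
      fun x y ↦ of_fourierForm_compContinuousLinearMap_add Φ e φ h x y⟩,
      fun a x ↦ of_fourierForm_compContinuousLinearMap_smul Φ e φ h a x⟩, fun _ ↦ rfl⟩
  obtain ⟨S, hS⟩ : ∃ S : (E [⋀^Fin k]→L[ℝ] ℂ) →ₗ[ℂ] GForm E ℂ,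
      ∀ x, S x = c • (hasLefschetzProperty_lefschetzG hη).weylOperator isZGrading_countingG (GForm.of k x) :=
    ⟨⟨⟨fun x ↦ c • (hasLefschetzProperty_lefschetzG hη).weylOperator isZGrading_countingG (GForm.of k x),
      fun x y ↦ smul_end_of_add _ c k x y⟩, fun a x ↦ smul_end_of_smul _ c a k x⟩, fun _ ↦ rfl⟩
  have hspan : Submodule.span ℂ (Set.range (wedgeWord (fun a ↦ (coord Φ a).smulRight (1 : ℂ)) (oneForm₀ E) k)) = ⊤ :=
    span_wedgeWord_const_eq_top (𝕜' := ℂ) (coord Φ) (fun a ↦ Φ (Pi.single a 1)) (sum_coord_smulRight_single Φ) k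
  have hTS : T = S := LinearMap.ext_on_range hspan fun w ↦ by rw [hT, hS]; exact hword k w m h
  rw [← hT, ← hS, hTS]

end Rigidity

/-! ## §4 The theorem: `φ_H^* ∘ F = (−1)^g d₁⋯d_g · w` for a polarisation of type `(d₁, …, d_g)` -/

section Polarised

variable [FiniteDimensional ℂ E] [Nontrivial E]

omit [FiniteDimensional ℂ E] [Nontrivial E] in
/-- `of (2g) (L^g 1) = of (2g) (η^{∧g})`: the top of the string through `1` is the wedge power, the reindexing `2g + 0 = 2g` and the
factor `∧ 1` being invisible on `GForm`. [cite: Huybrechts2005, §1.2 Prop. 1.2.30] -/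
private theorem of_lefschetzPow_oneForm₀ (η : E [⋀^Fin 2]→L[ℝ] ℝ) (g : ℕ) (h : 2 * g + 0 = 2 * g) :
    GForm.of (2 * g) (lefschetzPow η g h (oneForm₀ E)) = GForm.of (2 * g) (wedgePow (ofRealForm η) g) := by
  congr 1
  ext v
  rw [lefschetzPow_apply, ContinuousAlternatingMap.domDomCongr_apply, wedge_oneForm₀]
  exact congrArg _ (funext fun i ↦ congrArg v (Fin.ext rfl))

/-- **`w(1) = d₁⋯d_g · vol_X`** for a polarisation `η` of type `(d₁, …, d_g)`: `w(1) = ((−1)^g/g!) η^{∧g}` (row g51-#2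
`weylOperator_of_zero`, Bourbaki's `θ(t)e_n^{(m)}` formula) and `∫_X η^{∧g} = (−1)^g g! d₁⋯d_g` (Lemma 1.7.5, `torusIntegral_wedgePow_of_isPolarizationType`);
i.e. the Weyl operator sends the unit class to `χ(d)` times the point class (`χ(d) = d₁⋯d_g`; `N = 2g`, `h : 0 + N = N` only fixes the degree).
[cite: Lange2023AbelianVarietiesComplex, §1.7.2 Lemma 1.7.5 and proof of Thm. 1.7.3] [cite: Bourbaki2008LieGroups79, Ch. VIII §1 no. 5 (p. 96, formula (4))] -/
theorem IsPolarizationType.weylOperator_of_zero_oneForm₀ (hR : IsRiemannForm Φ η) {g : ℕ} {d : Fin g → ℕ} (hd : IsPolarizationType Φ η d)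
    (hη : ∀ v : E, v ≠ 0 → ∃ w : E, η ![v, w] ≠ 0) (e : Fin N ≃ ι) :
    (hasLefschetzProperty_lefschetzG hη).weylOperator isZGrading_countingG (GForm.of 0 (oneForm₀ E)) =
      (∏ i, (d i : ℂ)) • GForm.of N (volumeForm Φ e) := by
  have hcard : Fintype.card ι = N := by simpa using (Fintype.card_congr e).symm
  have hg : g = finrank ℂ E := by have := hd.card_eq; have := finrank_complex_mul_two Φ e; omega
  subst hg
  have hN : 2 * finrank ℂ E = N := by have := finrank_complex_mul_two Φ e; omega
  subst hN
  have hfact : ((finrank ℂ E).factorial : ℂ) ≠ 0 := by exact_mod_cast (Nat.factorial_pos _).ne'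
  rw [weylOperator_of_zero hη, lefschetzG_pow_of η (finrank ℂ E) (show 2 * finrank ℂ E + 0 = 2 * finrank ℂ E by omega),
    of_lefschetzPow_oneForm₀, eq_torusIntegral_smul_volumeForm Φ e (wedgePow (ofRealForm η) (finrank ℂ E)),
    hR.torusIntegral_wedgePow_of_isPolarizationType Φ hd e, GForm.of_smul, smul_smul]
  congr 1
  field_simp
  rw [← pow_mul, mul_comm (finrank ℂ E) 2, pow_mul, neg_one_sq, one_pow, one_mul]

/-- **THE COHOMOLOGICAL FOURIER TRANSFORM IS THE WEYL ELEMENT: `φ^*(F x) = (−1)^g · d₁⋯d_g · w(x)` for every `x ∈ Hᵏ(X; ℂ)`,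
`0 ≤ k ≤ 2g`**, for a complex torus `X` with a polarisation `η` of type `(d₁, …, d_g)`, every real-linear `φ : V → Ω̄` with
`Im φ(u)(w) = η(u, w)` (e.g. the analytic representation `φ_H` of `φ_L : X → X̂`), every lattice frame `e`, `k + m = N = 2g`, where
`w = exp(Λ_η) exp(−L_η) exp(Λ_η)` is the Weyl operator of the Lefschetz `𝔰𝔩₂` on `H•(X; ℂ) = GForm E ℂ`. By RIGIDITY (§3) it suffices to
compare on `H⁰`: `φ^*F(1) = (−1)^g det(E) vol_X = (−1)^g (d₁⋯d_g)² vol_X` (§1, `det E = (d₁⋯d_g)²`) and `w(1) = d₁⋯d_g vol_X`.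
In Polishchuk's normalisation `F_d = χ(d)⁻¹ φ^* ∘ F` (`χ(d) = d₁⋯d_g`): **`(−1)^g F_d = w`** — his Lemma 1.4 "`(−1)^g F_d = exp(e)exp(−f)exp(e)`"
in the tree's conventions for the triple `(L_η, Λ_η, H)`.
[cite: Polishchuk2007FourierStable, §1 Lemma 1.4 (p. 3)] [cite: Lange2023AbelianVarietiesComplex, §6.2.4 Prop. 6.2.20 p. 310; §1.5.1; §1.7.2 Lemma 1.7.5]
[cite: Andre1996Motifs, §1.2 (p. 11)] -/
theorem IsPolarizationType.of_fourierForm_compContinuousLinearMap (hR : IsRiemannForm Φ η) {g : ℕ} {d : Fin g → ℕ}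
    (hd : IsPolarizationType Φ η d) (hη : ∀ v : E, v ≠ 0 → ∃ w : E, η ![v, w] ≠ 0) (φ : E →L[ℝ] (E →L⋆[ℂ] ℂ))
    (hφ : ∀ u w, (φ u w).im = η ![u, w]) (e : Fin N ≃ ι) {k m : ℕ} (h : k + m = N) (x : E [⋀^Fin k]→L[ℝ] ℂ) :
    GForm.of m ((fourierForm Φ e h x).compContinuousLinearMap φ) =
      ((-1 : ℂ) ^ g * ∏ i, (d i : ℂ)) • (hasLefschetzProperty_lefschetzG hη).weylOperator isZGrading_countingG (GForm.of k x) := by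
  have hcard : Fintype.card ι = N := by simpa using (Fintype.card_congr e).symm
  have hg : g = finrank ℂ E := by have := hd.card_eq; have := finrank_complex_mul_two Φ e; omega
  subst hg
  refine of_fourierForm_compContinuousLinearMap_eq_smul_weylOperator Φ hη φ hφ e (Nat.zero_add N) ?_ h x
  rw [fourierForm_one_compContinuousLinearMap Φ φ hφ e, hd.polarizationDegree_eq, GForm.of_smul,
    hd.weylOperator_of_zero_oneForm₀ Φ hR hη e, smul_smul]
  congr 1
  push_cast
  ring

/-- **`φ_H^*(F x) = (−1)^g · d₁⋯d_g · w(x)`** with `φ = φ_H : v ↦ H(v, ·)` the analytic representation of the polarisation isogeny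
`φ_L : X → X̂` (`phiHRep`, Lemma 1.4.5; `Im φ_H(u)(w) = η(u, w)`). [cite: Polishchuk2007FourierStable, §1 Lemma 1.4 (p. 3)]
[cite: Lange2023AbelianVarietiesComplex, §1.4.2 Lemma 1.4.5; §6.2.4 Prop. 6.2.20 p. 310] -/
theorem IsPolarizationType.of_fourierForm_comp_phiHRep (hR : IsRiemannForm Φ η) {g : ℕ} {d : Fin g → ℕ}
    (hd : IsPolarizationType Φ η d) (hη : ∀ v : E, v ≠ 0 → ∃ w : E, η ![v, w] ≠ 0) (e : Fin N ≃ ι) {k m : ℕ} (h : k + m = N)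
    (x : E [⋀^Fin k]→L[ℝ] ℂ) :
    GForm.of m ((fourierForm Φ e h x).compContinuousLinearMap ((phiHRep Φ hR.1).restrictScalars ℝ)) =
      ((-1 : ℂ) ^ g * ∏ i, (d i : ℂ)) • (hasLefschetzProperty_lefschetzG hη).weylOperator isZGrading_countingG (GForm.of k x) :=
  hd.of_fourierForm_compContinuousLinearMap Φ hR hη _ (fun u w ↦ im_phiHFun η u w) e h x

/-- **For a principally polarised complex torus: `φ_H^* ∘ F = (−1)^g · w`** on every `Hᵏ(X; ℂ)` (`g = dim_ℂ X`; type `(1, …, 1)`,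
`χ(d) = 1`, `φ_L` an isomorphism) — "`(−1)^g F_d = exp(e)exp(−f)exp(e)`" with `F_d = φ^* ∘ F`.
[cite: Polishchuk2007FourierStable, §1 Lemma 1.4 (p. 3)] [cite: Lange2023AbelianVarietiesComplex, §6.2.4 Prop. 6.2.20 p. 310] -/
theorem IsPrincipalPolarization.of_fourierForm_comp_phiHRep (hp : IsPrincipalPolarization Φ η)
    (hη : ∀ v : E, v ≠ 0 → ∃ w : E, η ![v, w] ≠ 0) (e : Fin N ≃ ι) {k m : ℕ} (h : k + m = N) (x : E [⋀^Fin k]→L[ℝ] ℂ) :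
    GForm.of m ((fourierForm Φ e h x).compContinuousLinearMap ((phiHRep Φ hp.isRiemannForm.1).restrictScalars ℝ)) =
      ((-1 : ℂ) ^ finrank ℂ E) • (hasLefschetzProperty_lefschetzG hη).weylOperator isZGrading_countingG (GForm.of k x) := by
  obtain ⟨g, d, hd, h1⟩ := hp.exists_type_eq_one
  have hcard : Fintype.card ι = N := by simpa using (Fintype.card_congr e).symm
  have hg : g = finrank ℂ E := by have := hd.card_eq; have := finrank_complex_mul_two Φ e; omega
  subst hg
  rw [hd.of_fourierForm_comp_phiHRep Φ hp.isRiemannForm hη e h x]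
  simp [h1]

end Polarised

end ComplexTorus

end Literature.Geometry.Kaehler

end
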